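import Summits.ValiantsHypothesis.ValiantsHypothesis.Theorems.LacunarySymmetroidMatrixDescartesDoorA26WallBubblingMixMid

/-!
# Wall bubbling for `DoorA26` — TWO WEYL PAIRS: THE LORENTZ–GRAM IDENTITY OF THE MIXED BLOCK (symmetric letters)

HONEST FRAMING.  Obligation (W) `stub_weylFaces` of `Cruxes/DoorA26/Lines/wall_bubbling.lean` (crux `DoorA26`, stmt-ValiantsHypothesis-19979; OPEN,
typed, never asserted); W1 seat val-sym-door-p2 g14.  First of three files towards the REPAIRED three-scale rule `MixThree26'` of rev 9 of
`Cruxes/DoorA26/Lines/wall_bubbling_ConfluentDoor.lean` (the rev-8 rule `MixThree26`, letters over all of `M₂(ℝ)`, is FALSE — crit-5 g4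
`not_MixThree26`, isotropic planes of `polar` on `M₂(ℝ)`; the repair adds `(∀ ν l, (U ν l).IsSymm)` and `δ0 0 ≠ δ0 1`).

THE ONE PLACE WHERE SYMMETRY ENTERS.  On `Sym₂(ℝ) ≅ ℝ^{1,2}` the form `polar` (`polar S S = det S`) has signature `(1,2)`, so four symmetric letters
`V₀, V₅, V₁, V₄` have a SINGULAR `4 × 4` polar Gram matrix; written in the blocks `E = (g₀₀ g₀₅; g₀₅ g₅₅)` (class `2δ₀`), `B = (g₁₁ g₁₄; g₁₄ g₄₄)`
(class `2δ₁`), `M = (g₀₁ g₀₄; g₅₁ g₅₄)` (the mixed class) this is the polynomial identity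

* **`mixedBlock_det_sq`**: `(g₀₁g₅₄ − g₀₄g₅₁)² = tr(adj E · M · adj B · Mᵀ) − det E · det B` (explicit 14-monomial right-hand side; `ring` on the
  twelve free entries), hence
* **`mixedBlock_det_sq_le`**: `(g₀₁g₅₄ − g₀₄g₅₁)² ≤ 20 · η_E · η_B · μ²` whenever the `E`-entries are `≤ η_E`, the `B`-entries `≤ η_B` and all entries
  `≤ μ` (`η_E, η_B ≤ μ`) — so the mixed block is NEARLY RANK ONE as soon as ONE pure class is negligible, which at a value-generic two-pair point
  (`δ0 0 ≠ δ0 1`) is forced at every later scale by the weight separation `e^{(δ₀−δ₁)S}` (next file).  For non-symmetric letters the identity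
  fails (`E = B = 0`, `det M ≠ 0` on the isotropic planes) — exactly crit-5's / door-p2 g14's witness against the unprimed rule.

Registers unchanged; (W), `MixThree26'`, `DoorA26` 19979, 18050 OPEN; nothing on VP ≠ VNP.  Def-free.  `--supports stmt-ValiantsHypothesis-19979 --as helper`.
-/

-- `Summit.ValiantsHypothesis.ValiantsHypothesis.…` repeats a component by the D-0017 layout
-- (single-conjunct summit), which the `dupNamespace` linter flags; the name is mandated.
set_option linter.dupNamespace false

namespace Summit.ValiantsHypothesis.ValiantsHypothesis.Theorems.LacunarySymmetroidMatrixDescartes.WallBubbling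

open Finset Filter Topology
open Bubbling (polar polar_apply polar_comm polar_smul_left_right)
open scoped BigOperators

/-- `polar` of two SYMMETRIC `2 × 2` matrices in the three free entries of each. [folklore] -/
theorem polar_apply_symm (S T : Matrix (Fin 2) (Fin 2) ℝ) (hS : S.IsSymm) (hT : T.IsSymm) :
    polar S T = (S 0 0 * T 1 1 + T 0 0 * S 1 1 - 2 * S 0 1 * T 0 1) / 2 := by
  have hS10 : S 1 0 = S 0 1 := by
    have := congrFun (congrFun hS 0) 1
    simpa [Matrix.transpose_apply] using this
  have hT10 : T 1 0 = T 0 1 := by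
    have := congrFun (congrFun hT 0) 1
    simpa [Matrix.transpose_apply] using this
  rw [polar_apply, hS10, hT10]
  ring

/-- **THE LORENTZ–GRAM IDENTITY OF THE MIXED BLOCK** for four symmetric letters `V₀, V₅, V₁, V₄` (singular `4 × 4` polar Gram matrix on
`Sym₂(ℝ) ≅ ℝ^{1,2}`): `(g₀₁g₅₄ − g₀₄g₅₁)² = tr(adj E·M·adj B·Mᵀ) − det E·det B`, written out. [this work] -/
theorem mixedBlock_det_sq (V₀ V₅ V₁ V₄ : Matrix (Fin 2) (Fin 2) ℝ) (h₀ : V₀.IsSymm) (h₅ : V₅.IsSymm) (h₁ : V₁.IsSymm) (h₄ : V₄.IsSymm) :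
    (polar V₀ V₁ * polar V₅ V₄ - polar V₀ V₄ * polar V₅ V₁) ^ 2
      = polar V₅ V₅ * (polar V₄ V₄ * polar V₀ V₁ ^ 2 - 2 * polar V₁ V₄ * polar V₀ V₁ * polar V₀ V₄ + polar V₁ V₁ * polar V₀ V₄ ^ 2)
        + polar V₀ V₀ * (polar V₄ V₄ * polar V₅ V₁ ^ 2 - 2 * polar V₁ V₄ * polar V₅ V₁ * polar V₅ V₄ + polar V₁ V₁ * polar V₅ V₄ ^ 2)
        - 2 * polar V₀ V₅ * (polar V₄ V₄ * polar V₅ V₁ * polar V₀ V₁ - polar V₁ V₄ * (polar V₅ V₁ * polar V₀ V₄ + polar V₅ V₄ * polar V₀ V₁)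
            + polar V₁ V₁ * polar V₅ V₄ * polar V₀ V₄)
        - (polar V₀ V₀ * polar V₅ V₅ - polar V₀ V₅ ^ 2) * (polar V₁ V₁ * polar V₄ V₄ - polar V₁ V₄ ^ 2) := by
  simp only [polar_apply_symm _ _ h₀ h₁, polar_apply_symm _ _ h₅ h₄, polar_apply_symm _ _ h₀ h₄, polar_apply_symm _ _ h₅ h₁,
    polar_apply_symm _ _ h₅ h₅, polar_apply_symm _ _ h₄ h₄, polar_apply_symm _ _ h₁ h₄, polar_apply_symm _ _ h₁ h₁,
    polar_apply_symm _ _ h₀ h₀, polar_apply_symm _ _ h₀ h₅]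
  ring

/-- Scalar bound of the right-hand side: `E`-entries `≤ η_E`, `B`-entries `≤ η_B`, all entries `≤ μ`, `η_E, η_B ≤ μ`
⇒ `|tr(adj E·M·adj B·Mᵀ) − det E·det B| ≤ 20 η_E η_B μ²`. [this work] -/
theorem gramRHS_abs_le {g₀₀ g₀₅ g₅₅ g₁₁ g₁₄ g₄₄ g₀₁ g₀₄ g₅₁ g₅₄ ηE ηB μ : ℝ}
    (h00 : |g₀₀| ≤ ηE) (h05 : |g₀₅| ≤ ηE) (h55 : |g₅₅| ≤ ηE) (h11 : |g₁₁| ≤ ηB) (h14 : |g₁₄| ≤ ηB) (h44 : |g₄₄| ≤ ηB)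
    (h01 : |g₀₁| ≤ μ) (h04 : |g₀₄| ≤ μ) (h51 : |g₅₁| ≤ μ) (h54 : |g₅₄| ≤ μ) (hE : ηE ≤ μ) (hB : ηB ≤ μ) :
    |g₅₅ * (g₄₄ * g₀₁ ^ 2 - 2 * g₁₄ * g₀₁ * g₀₄ + g₁₁ * g₀₄ ^ 2)
        + g₀₀ * (g₄₄ * g₅₁ ^ 2 - 2 * g₁₄ * g₅₁ * g₅₄ + g₁₁ * g₅₄ ^ 2)
        - 2 * g₀₅ * (g₄₄ * g₅₁ * g₀₁ - g₁₄ * (g₅₁ * g₀₄ + g₅₄ * g₀₁) + g₁₁ * g₅₄ * g₀₄)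
        - (g₀₀ * g₅₅ - g₀₅ ^ 2) * (g₁₁ * g₄₄ - g₁₄ ^ 2)| ≤ 20 * ηE * ηB * μ ^ 2 := by
  have hE0 : 0 ≤ ηE := le_trans (abs_nonneg _) h00
  have hB0 : 0 ≤ ηB := le_trans (abs_nonneg _) h11
  have hμ0 : 0 ≤ μ := le_trans (abs_nonneg _) h01
  -- fourteen monomials, each `≤ ηE ηB μ²`
  have m : ∀ (a b c d : ℝ), |a| ≤ ηE → |b| ≤ ηB → |c| ≤ μ → |d| ≤ μ → |a * b * c * d| ≤ ηE * ηB * μ ^ 2 := by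
    intro a b c d ha hb hc hd
    rw [abs_mul, abs_mul, abs_mul, pow_two]
    have h1 : |a| * |b| ≤ ηE * ηB := mul_le_mul ha hb (abs_nonneg _) hE0
    have h2 : |c| * |d| ≤ μ * μ := mul_le_mul hc hd (abs_nonneg _) hμ0
    calc |a| * |b| * |c| * |d| = (|a| * |b|) * (|c| * |d|) := by ring
      _ ≤ (ηE * ηB) * (μ * μ) := mul_le_mul h1 h2 (by positivity) (by positivity)
      _ = ηE * ηB * (μ * μ) := by ring
  -- the pure-pure monomials: `|g₀₀ g₅₅ g₁₁ g₄₄| ≤ ηE μ ηB μ` etc.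
  have m' : ∀ (a a' b b' : ℝ), |a| ≤ ηE → |a'| ≤ μ → |b| ≤ ηB → |b'| ≤ μ → |a * a' * b * b'| ≤ ηE * ηB * μ ^ 2 := by
    intro a a' b b' ha ha' hb hb'
    have := m a b a' b' ha hb ha' hb'
    rw [show a * a' * b * b' = a * b * a' * b' by ring]
    exact this
  have h55μ : |g₅₅| ≤ μ := le_trans h55 hE
  have h05μ : |g₀₅| ≤ μ := le_trans h05 hE
  have h44μ : |g₄₄| ≤ μ := le_trans h44 hB
  have h14μ : |g₁₄| ≤ μ := le_trans h14 hB
  have t1 := m g₅₅ g₄₄ g₀₁ g₀₁ h55 h44 h01 h01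
  have t2 := m g₅₅ g₁₄ g₀₁ g₀₄ h55 h14 h01 h04
  have t3 := m g₅₅ g₁₁ g₀₄ g₀₄ h55 h11 h04 h04
  have t4 := m g₀₀ g₄₄ g₅₁ g₅₁ h00 h44 h51 h51
  have t5 := m g₀₀ g₁₄ g₅₁ g₅₄ h00 h14 h51 h54
  have t6 := m g₀₀ g₁₁ g₅₄ g₅₄ h00 h11 h54 h54
  have t7 := m g₀₅ g₄₄ g₅₁ g₀₁ h05 h44 h51 h01
  have t8 := m g₀₅ g₁₄ g₅₁ g₀₄ h05 h14 h51 h04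
  have t9 := m g₀₅ g₁₄ g₅₄ g₀₁ h05 h14 h54 h01
  have t10 := m g₀₅ g₁₁ g₅₄ g₀₄ h05 h11 h54 h04
  have t11 := m' g₀₀ g₅₅ g₁₁ g₄₄ h00 h55μ h11 h44μ
  have t12 := m' g₀₀ g₅₅ g₁₄ g₁₄ h00 h55μ h14 h14μ
  have t13 := m' g₀₅ g₀₅ g₁₁ g₄₄ h05 h05μ h11 h44μ
  have t14 := m' g₀₅ g₀₅ g₁₄ g₁₄ h05 h05μ h14 h14μ
  -- assemble: two-sided bounds on the fourteen monomials, then linear arithmetic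
  have b1 := abs_le.mp t1; have b2 := abs_le.mp t2; have b3 := abs_le.mp t3; have b4 := abs_le.mp t4
  have b5 := abs_le.mp t5; have b6 := abs_le.mp t6; have b7 := abs_le.mp t7; have b8 := abs_le.mp t8
  have b9 := abs_le.mp t9; have b10 := abs_le.mp t10; have b11 := abs_le.mp t11; have b12 := abs_le.mp t12
  have b13 := abs_le.mp t13; have b14 := abs_le.mp t14
  rw [abs_le]
  constructor
  · linarith [b1.1, b2.2, b3.1, b4.1, b5.2, b6.1, b7.2, b8.1, b9.1, b10.2, b11.2, b12.1, b13.1, b14.2,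
      b1.2, b2.1, b3.2, b4.2, b5.1, b6.2, b7.1, b8.2, b9.2, b10.1, b11.1, b12.2, b13.2, b14.1]
  · linarith [b1.1, b2.2, b3.1, b4.1, b5.2, b6.1, b7.2, b8.1, b9.1, b10.2, b11.2, b12.1, b13.1, b14.2,
      b1.2, b2.1, b3.2, b4.2, b5.1, b6.2, b7.1, b8.2, b9.2, b10.1, b11.1, b12.2, b13.2, b14.1]

/-- **THE MIXED BLOCK IS NEARLY RANK ONE WHEN ONE PURE CLASS IS NEGLIGIBLE** (symmetric letters):
`(g₀₁g₅₄ − g₀₄g₅₁)² ≤ 20 η_E η_B μ²`. [this work] -/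
theorem mixedBlock_det_sq_le (V₀ V₅ V₁ V₄ : Matrix (Fin 2) (Fin 2) ℝ) (h₀ : V₀.IsSymm) (h₅ : V₅.IsSymm) (h₁ : V₁.IsSymm) (h₄ : V₄.IsSymm)
    {ηE ηB μ : ℝ} (h00 : |polar V₀ V₀| ≤ ηE) (h05 : |polar V₀ V₅| ≤ ηE) (h55 : |polar V₅ V₅| ≤ ηE)
    (h11 : |polar V₁ V₁| ≤ ηB) (h14 : |polar V₁ V₄| ≤ ηB) (h44 : |polar V₄ V₄| ≤ ηB)
    (h01 : |polar V₀ V₁| ≤ μ) (h04 : |polar V₀ V₄| ≤ μ) (h51 : |polar V₅ V₁| ≤ μ) (h54 : |polar V₅ V₄| ≤ μ) (hE : ηE ≤ μ) (hB : ηB ≤ μ) :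
    (polar V₀ V₁ * polar V₅ V₄ - polar V₀ V₄ * polar V₅ V₁) ^ 2 ≤ 20 * ηE * ηB * μ ^ 2 := by
  rw [mixedBlock_det_sq V₀ V₅ V₁ V₄ h₀ h₅ h₁ h₄]
  exact le_trans (le_abs_self _) (gramRHS_abs_le h00 h05 h55 h11 h14 h44 h01 h04 h51 h54 hE hB)

end Summit.ValiantsHypothesis.ValiantsHypothesis.Theorems.LacunarySymmetroidMatrixDescartes.WallBubbling
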